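import Literature.NumberTheory.QuadraticFields.SqrtNegTwoRingOfIntegers
import Literature.NumberTheory.NumberFields.ImaginaryQuadraticEmbedding
import Literature.NumberTheory.Automorphic.GaloisActionPlaces
import HarnessLib

/-!
# The primes of `𝓞 ℚ(√−2)` read in `ℤ[√−2]`: generators, complex conjugation as `star`, the ramified prime `(√−2)` and the
# modulus `(4√−2)` of Rajwade's primary elements

Topic `Literature/NumberTheory/QuadraticFields`, namespace `Literature.NumberTheory.QuadraticFields.SqrtNegTwo`.  THEOREMS and six small
definitions (`FieldData`, `FieldData.ringEquiv` / `toComplex` / `sqrtIdeal` / `modulus`, `gen`); no instance, no notation, no named fact.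
The `ℚ(√−2)` twin of `OmegaPrimeFieldPrimes` (there: `ℚ(√−q)`, `q ≡ 3 (mod 4)`), on Mathlib's `ℤ√(-2)` through `SqrtNegTwoIntegers.equivIntegers :
ℤ√(-2) ≃+* 𝓞 K`; first half of the ideal-theoretic Größencharakter of the `j = 8000` curves (`SqrtNegTwoGrossencharakter.lean`;
Rajwade 1968, Silverberg 2010 Thm. 2.7: `a_p = π + π̄` for the PRIMARY `π`, `π ≡ 1, 3, 1 ± √−2, 3 ± √−2, 5 + 2√−2, 7 + 2√−2 (mod 4√−2)`).

For a number field `K` with `[K : ℚ] = 2` containing `θ` with `θ² = −2` (`FieldData θ`; `K = ℚ(√−2)`, `𝓞 K = ℤ[θ]`, `ℤ[√−2]` Euclidean):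

* §1 `hK.ringEquiv : ℤ√(-2) ≃+* 𝓞 K`, `hK.toComplex e`, `θ ∉ ℚ`, one infinite place (`infinitePlace_eq`), the non-trivial automorphism `c`:
  `c θ = −θ`, ★ `smul_ringEquiv : c • z = z̄`, ★ `embedding_algEquiv : e(c x) = conj e(x)`; the prime `hK.sqrtIdeal = (√−2)` and the modulus
  `hK.modulus = (4√−2) = (√−2)⁵` (`modulus_eq_sqrtIdeal_pow`); `√−2 ∣ z ↔ 2 ∣ re z`, `4√−2 ∣ z ↔ 8 ∣ re z ∧ 4 ∣ im z`; `primary` is constant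
  on classes mod `4√−2` up to the common sign (`primary_mul_eq_primary_mul_of_dvd_sub`); `primaryHom`;
* §2 ★ `gen hK v ∈ ℤ√(-2)` — a generator of the prime `𝔭_v` of `𝓞 K` (`span_ringEquiv_gen`, `mem_asIdeal_iff`), `c • 𝔭_v = ((gen v)‾)`
  (`smul_asIdeal_eq`, `associated_gen_smul`), ★ `sqrtIdeal_le_iff : (√−2) ∣ 𝔭_v ↔ re(gen v) even`, `modulus_le_iff`, `sqrtIdeal_le_iff_two_mem`.

Nothing about BSD is proved here.

## References
* A. R. Rajwade, *Arithmetic on curves with complex multiplication by √−2*, Proc. Cambridge Philos. Soc. 64 (1968), Thm. 1. [Rajwade1968]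
* A. Silverberg, *Group order formulas for reductions of CM elliptic curves*, Contemp. Math. 521 (2010), Thm. 2.7. [Silverberg2010]
* D. A. Marcus, *Number Fields*, 2nd ed. (2018), Ch. 2 Thm. 1, Ch. 3 Thm. 25. [Marcus2018]
* J. H. Silverman, *Advanced Topics in the Arithmetic of Elliptic Curves* (1994), II §2 and Ex. 2.30. [SilvermanATAEC1994]

## Mathlib / tree search
Tree: `SqrtNegTwoIntegers.{equivIntegers, coe_equivIntegers, coe_equivIntegers_sqrtd, algEquiv_theta, not_mem_range}`, `SqrtNegTwoPrimary.{IsPrimary, primary,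
primary_mul, primary_of_isUnit, primary_neg, norm_emod_two, prime_of_norm_eq_prime, eq_of_isUnit}`, `Quadratic.exists_eq_add_mul`,
`Automorphic.{instMulActionHeightOneSpectrum, HeightOneSpectrum.smul_asIdeal, RingOfIntegers.coe_algEquiv_smul}`, `ImaginaryQuadratic.infinitePlace_eq`,
the `EuclideanDomain (ℤ√(-2))` instance (`MordellEquationMinusTwo`).  Mathlib: `Zsqrtd.{star_mk, norm_mul, norm_eq_one_iff', norm_natCast}`,
`Ideal.span_singleton_generator`, `Ideal.map_comap_of_surjective`, `Ideal.span_singleton_eq_span_singleton`, `Ideal.pointwise_smul_def`,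
`Ideal.span_singleton_prime`, `Ideal.IsPrime.pow_le_iff`, `Irreducible.associated_of_dvd`, `map_dvd_iff`.
-/

noncomputable section

open NumberField IsDedekindDomain
open scoped ComplexConjugate Pointwise

namespace Literature.NumberTheory.QuadraticFields.SqrtNegTwo

open Literature.NumberTheory.QuadraticFields.SqrtNegTwoIntegers (equivIntegers coe_equivIntegers coe_equivIntegers_sqrtd)
open Literature.NumberTheory.QuadraticFields.SqrtNegTwoPrimary
open Literature.NumberTheory.QuadraticFields.Quadratic (exists_eq_add_mul)
open Literature.NumberTheory.Automorphic (RingOfIntegers.coe_algEquiv_smul)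

variable {K : Type*} [Field K] [NumberField K] {θ : K}

/-! ### §1 The standing hypotheses and the transport `ℤ[√−2] ≃ 𝓞 K` -/

/-- **The standing hypotheses**: `K` is a quadratic number field containing `θ` with `θ² = −2` (`K = ℚ(√−2)`, `𝓞 K = ℤ[√−2]`).
[cite: Rajwade1968, Thm. 1] -/
structure FieldData (θ : K) : Prop where
  finrank_eq : Module.finrank ℚ K = 2
  sq_eq : θ ^ 2 = -2

namespace FieldData

/-- `θ ∉ ℚ`. [cite: Marcus2018, Ch. 2 Thm. 1] -/
theorem not_mem_range (hK : FieldData θ) : θ ∉ Set.range (algebraMap ℚ K) := SqrtNegTwoIntegers.not_mem_range hK.sq_eq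

/-- **`𝓞 K = ℤ[√−2]`**: the ring isomorphism `ℤ√(-2) ≃+* 𝓞 K` (`SqrtNegTwoIntegers.equivIntegers`). [cite: Marcus2018, Ch. 2 Thm. 1 and Cor. 2] -/
def ringEquiv (hK : FieldData θ) : ℤ√(-2) ≃+* 𝓞 K := equivIntegers hK.finrank_eq hK.sq_eq

/-- `hK.ringEquiv z`, in `K`, is `z.re + z.im · θ`. [cite: Marcus2018, Ch. 2 Thm. 1 and Cor. 2] -/
theorem coe_ringEquiv (hK : FieldData θ) (z : ℤ√(-2)) : ((hK.ringEquiv z : 𝓞 K) : K) = (z.re : K) + (z.im : K) * θ :=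
  coe_equivIntegers hK.finrank_eq hK.sq_eq z

/-- `hK.ringEquiv √−2 = θ`. [cite: Marcus2018, Ch. 2 Thm. 1 and Cor. 2] -/
theorem coe_ringEquiv_sqrtd (hK : FieldData θ) : ((hK.ringEquiv Zsqrtd.sqrtd : 𝓞 K) : K) = θ :=
  coe_equivIntegers_sqrtd hK.finrank_eq hK.sq_eq

/-- Integers `n ∈ ℤ ⊂ ℤ[√−2]` go to `n` under `ℤ[√−2] ≃ 𝓞 K`. [cite: Marcus2018, Ch. 2 Thm. 1 and Cor. 2] -/
theorem ringEquiv_intCast (hK : FieldData θ) (n : ℤ) : hK.ringEquiv (n : ℤ√(-2)) = n := map_intCast _ n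

/-- Naturals `n ∈ ℕ ⊂ ℤ[√−2]` go to `n` under `ℤ[√−2] ≃ 𝓞 K`. [cite: Marcus2018, Ch. 2 Thm. 1 and Cor. 2] -/
theorem ringEquiv_natCast (hK : FieldData θ) (n : ℕ) : hK.ringEquiv (n : ℤ√(-2)) = n := map_natCast _ n

/-- **The embedding `ℤ[√−2] → ℂ` through `e : K → ℂ`** (plumbing def). [cite: Marcus2018, Ch. 2 Thm. 1 and Cor. 2] -/
def toComplex (hK : FieldData θ) (e : K →+* ℂ) : ℤ√(-2) →+* ℂ :=
  e.comp ((algebraMap (𝓞 K) K).comp (hK.ringEquiv : ℤ√(-2) →+* 𝓞 K))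

/-- Unfolding `toComplex`. [cite: Marcus2018, Ch. 2 Thm. 1 and Cor. 2] -/
theorem toComplex_apply (hK : FieldData θ) (e : K →+* ℂ) (z : ℤ√(-2)) : hK.toComplex e z = e ((hK.ringEquiv z : 𝓞 K) : K) := rfl

/-- `toComplex` is injective. [cite: Marcus2018, Ch. 2 Thm. 1 and Cor. 2] -/
theorem toComplex_injective (hK : FieldData θ) (e : K →+* ℂ) : Function.Injective (hK.toComplex e) :=
  e.injective.comp ((RingOfIntegers.coe_injective).comp hK.ringEquiv.injective)

/-- `toComplex z = 0 ↔ z = 0`. [cite: Marcus2018, Ch. 2 Thm. 1 and Cor. 2] -/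
theorem toComplex_eq_zero_iff (hK : FieldData θ) (e : K →+* ℂ) (z : ℤ√(-2)) : hK.toComplex e z = 0 ↔ z = 0 :=
  map_eq_zero_iff _ (hK.toComplex_injective e)

/-- `K` is totally complex (`θ² = −2 < 0` has no real root). [cite: Marcus2018, Ch. 2 (the two embeddings of ℚ[√m], m < 0)] -/
theorem isTotallyComplex (hK : FieldData θ) : IsTotallyComplex K := by
  refine ⟨fun w => ?_⟩
  rw [← InfinitePlace.not_isReal_iff_isComplex]
  intro hw
  have h := congrArg (InfinitePlace.embedding_of_isReal hw) hK.sq_eq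
  rw [map_pow, map_neg, map_ofNat] at h
  nlinarith [sq_nonneg (InfinitePlace.embedding_of_isReal hw θ)]

/-- `K = ℚ(√−2)` has a single infinite place. [cite: Marcus2018, Ch. 2 (the two embeddings of ℚ[√m], m < 0)] -/
theorem infinitePlace_eq (hK : FieldData θ) (w w' : InfinitePlace K) : w = w' := by
  haveI := hK.isTotallyComplex
  exact NumberFields.ImaginaryQuadratic.infinitePlace_eq hK.finrank_eq w w'

/-- **The non-trivial automorphism of `K` is `θ ↦ −θ`.** [cite: SilvermanATAEC1994, II §2 (complex conjugation on K)] -/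
theorem algEquiv_theta (hK : FieldData θ) {c : K ≃ₐ[ℚ] K} (hc : c ≠ 1) : c θ = -θ :=
  SqrtNegTwoIntegers.algEquiv_theta hK.finrank_eq hK.sq_eq hc

/-- `c(z.re + z.im θ) = z̄.re + z̄.im θ`: on `ℤ[√−2] ⊂ K` the non-trivial automorphism is `star`.
[cite: SilvermanATAEC1994, II §2 and Ex. 2.30 (complex conjugation on the CM field K)] -/
theorem algEquiv_coe_ringEquiv (hK : FieldData θ) {c : K ≃ₐ[ℚ] K} (hc : c ≠ 1) (z : ℤ√(-2)) :
    c ((hK.ringEquiv z : 𝓞 K) : K) = ((hK.ringEquiv (star z) : 𝓞 K) : K) := by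
  rw [hK.coe_ringEquiv, hK.coe_ringEquiv, map_add, map_mul, map_intCast, map_intCast, hK.algEquiv_theta hc,
    Zsqrtd.re_star, Zsqrtd.im_star]
  push_cast
  ring

/-- **`c • z = z̄` on `𝓞 K = ℤ[√−2]`.** [cite: SilvermanATAEC1994, II §2 and Ex. 2.30 (complex conjugation on the CM field K)] -/
theorem smul_ringEquiv (hK : FieldData θ) {c : K ≃ₐ[ℚ] K} (hc : c ≠ 1) (z : ℤ√(-2)) :
    c • hK.ringEquiv z = hK.ringEquiv (star z) := by
  apply RingOfIntegers.ext
  rw [RingOfIntegers.coe_algEquiv_smul, hK.algEquiv_coe_ringEquiv hc]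

/-- `e(θ)` is purely imaginary for every embedding `e : K → ℂ`. [cite: Marcus2018, Ch. 2 (the two embeddings of ℚ[√m], m < 0)] -/
theorem embedding_theta_re (hK : FieldData θ) (e : K →+* ℂ) : (e θ).re = 0 := by
  have h : (e θ) ^ 2 = -2 := by rw [← map_pow, hK.sq_eq, map_neg, map_ofNat]
  have hre : (e θ).re * (e θ).re - (e θ).im * (e θ).im = -2 := by
    have := congrArg Complex.re h
    simpa [sq, Complex.mul_re] using this
  have him : (e θ).re * (e θ).im = 0 := by
    have := congrArg Complex.im h
    simp only [sq, Complex.mul_im, Complex.neg_im] at this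
    norm_num at this
    linarith
  by_contra hne
  have him0 : (e θ).im = 0 := by
    rcases mul_eq_zero.mp him with h0 | h0
    · exact absurd h0 hne
    · exact h0
  rw [him0, mul_zero, sub_zero] at hre
  nlinarith [mul_self_nonneg (e θ).re]

/-- `conj e(θ) = −e(θ)`. [cite: Marcus2018, Ch. 2 (the two embeddings of ℚ[√m], m < 0)] -/
theorem conj_embedding_theta (hK : FieldData θ) (e : K →+* ℂ) : conj (e θ) = -(e θ) := by
  apply Complex.ext
  · rw [Complex.conj_re, Complex.neg_re, hK.embedding_theta_re e, neg_zero]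
  · rw [Complex.conj_im, Complex.neg_im]

/-- **`e ∘ c = conj ∘ e`**: the non-trivial automorphism of `K = ℚ(√−2)` is complex conjugation in every complex embedding.
[cite: SilvermanATAEC1994, II §2 (complex conjugation on K)] -/
theorem embedding_algEquiv (hK : FieldData θ) (e : K →+* ℂ) {c : K ≃ₐ[ℚ] K} (hc : c ≠ 1) (x : K) :
    e (c x) = conj (e x) := by
  obtain ⟨r, s, rfl⟩ := exists_eq_add_mul hK.finrank_eq hK.not_mem_range x
  have hr : ∀ t : ℚ, e (algebraMap ℚ K t) = (t : ℂ) := fun t => eq_ratCast (e.comp (algebraMap ℚ K)) t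
  rw [map_add, map_mul, AlgEquiv.commutes, AlgEquiv.commutes, hK.algEquiv_theta hc, map_add, map_mul, map_neg, hr, hr,
    map_add, map_mul, hr, hr, map_add, map_mul, map_ratCast, map_ratCast, hK.conj_embedding_theta e]

/-- The ramified prime **`(√−2) = (θ)`** of `𝓞 K`. [cite: Rajwade1968, Thm. 1] -/
def sqrtIdeal (hK : FieldData θ) : Ideal (𝓞 K) := Ideal.span {hK.ringEquiv Zsqrtd.sqrtd}

/-- The modulus **`(4√−2) = (√−2)⁵`** of Rajwade's primary elements. [cite: Rajwade1968, Thm. 1] -/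
def modulus (hK : FieldData θ) : Ideal (𝓞 K) := Ideal.span {hK.ringEquiv (4 * Zsqrtd.sqrtd)}

/-- `(√−2) ≠ 0`. [cite: Rajwade1968, Thm. 1] -/
theorem sqrtIdeal_ne_bot (hK : FieldData θ) : hK.sqrtIdeal ≠ ⊥ := by
  rw [sqrtIdeal, Ne, Ideal.span_singleton_eq_bot, map_eq_zero_iff _ hK.ringEquiv.injective]
  intro h
  have := congrArg Zsqrtd.im h
  simp [Zsqrtd.sqrtd] at this

/-- `4√−2 = (√−2)⁵` in `ℤ[√−2]`. [cite: Rajwade1968, Thm. 1] -/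
theorem four_mul_sqrtd_eq_pow : (4 * Zsqrtd.sqrtd : ℤ√(-2)) = Zsqrtd.sqrtd ^ 5 := by
  ext <;> simp [Zsqrtd.sqrtd, pow_succ]

/-- `(4√−2) = (√−2)⁵` as ideals. [cite: Rajwade1968, Thm. 1] -/
theorem modulus_eq_sqrtIdeal_pow (hK : FieldData θ) : hK.modulus = hK.sqrtIdeal ^ 5 := by
  rw [modulus, sqrtIdeal, four_mul_sqrtd_eq_pow, map_pow, Ideal.span_singleton_pow]

/-- `(4√−2) ≠ 0`. [cite: Rajwade1968, Thm. 1] -/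
theorem modulus_ne_bot (hK : FieldData θ) : hK.modulus ≠ ⊥ := by
  rw [modulus_eq_sqrtIdeal_pow]; exact pow_ne_zero 5 hK.sqrtIdeal_ne_bot

end FieldData

/-- `N(√−2) = 2`. [cite: Rajwade1968, Thm. 1] -/
theorem norm_sqrtd : (Zsqrtd.sqrtd : ℤ√(-2)).norm = 2 := by
  rw [Zsqrtd.norm_def]; simp [Zsqrtd.sqrtd]

/-- **`√−2 ∣ z ↔ 2 ∣ re z`** (`√−2 · (x + y√−2) = −2y + x√−2`). [cite: Rajwade1968, Thm. 1] -/
theorem sqrtd_dvd_iff (z : ℤ√(-2)) : (Zsqrtd.sqrtd : ℤ√(-2)) ∣ z ↔ 2 ∣ z.re := by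
  constructor
  · rintro ⟨t, ht⟩
    refine ⟨-t.im, ?_⟩
    have := congrArg Zsqrtd.re ht
    simp [Zsqrtd.sqrtd, Zsqrtd.re_mul] at this
    linarith
  · rintro ⟨k, hk⟩
    refine ⟨⟨z.im, -k⟩, ?_⟩
    ext <;> simp [Zsqrtd.sqrtd, Zsqrtd.re_mul, Zsqrtd.im_mul, hk]

/-- **`4√−2 ∣ z ↔ 8 ∣ re z ∧ 4 ∣ im z`** (`4√−2 · (x + y√−2) = −8y + 4x√−2`). [cite: Rajwade1968, Thm. 1] -/
theorem four_mul_sqrtd_dvd_iff (z : ℤ√(-2)) : (4 * Zsqrtd.sqrtd : ℤ√(-2)) ∣ z ↔ 8 ∣ z.re ∧ 4 ∣ z.im := by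
  constructor
  · rintro ⟨t, ht⟩
    have hre := congrArg Zsqrtd.re ht
    have him := congrArg Zsqrtd.im ht
    simp [Zsqrtd.sqrtd, Zsqrtd.re_mul, Zsqrtd.im_mul] at hre him
    exact ⟨⟨-t.im, by linarith⟩, ⟨t.re, by linarith⟩⟩
  · rintro ⟨⟨k, hk⟩, ⟨l, hl⟩⟩
    refine ⟨⟨l, -k⟩, ?_⟩
    ext <;> simp [Zsqrtd.sqrtd, Zsqrtd.re_mul, Zsqrtd.im_mul, hk, hl]

/-- Rajwade's class `H` only sees `im z (mod 4)`: `primaryRes r s ↔ primaryRes r (s + 4)`. [cite: Rajwade1968, Thm. 1] -/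
theorem primaryRes_add_four_iff (r s : ZMod 8) : primaryRes r s ↔ primaryRes r (s + 4) := by
  revert r s; decide

/-- **Primarity is a congruence condition modulo `4√−2`**: if `4√−2 ∣ b − c` then `b` is primary iff `c` is. [cite: Rajwade1968, Thm. 1] -/
theorem isPrimary_iff_of_dvd_sub {b c : ℤ√(-2)} (h : (4 * Zsqrtd.sqrtd : ℤ√(-2)) ∣ b - c) : IsPrimary b ↔ IsPrimary c := by
  obtain ⟨⟨k, hk⟩, ⟨l, hl⟩⟩ := (four_mul_sqrtd_dvd_iff _).mp h
  rw [Zsqrtd.re_sub] at hk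
  rw [Zsqrtd.im_sub] at hl
  have hre : (b.re : ZMod 8) = (c.re : ZMod 8) := by
    rw [show b.re = c.re + 8 * k by linarith]; push_cast; rw [show (8 : ZMod 8) = 0 from rfl]; ring
  have him : (b.im : ZMod 8) = (c.im : ZMod 8) ∨ (b.im : ZMod 8) = (c.im : ZMod 8) + 4 := by
    rcases Int.even_or_odd l with ⟨j, hj⟩ | ⟨j, hj⟩
    · left; rw [show b.im = c.im + 8 * j by linarith]; push_cast; rw [show (8 : ZMod 8) = 0 from rfl]; ring
    · right; rw [show b.im = c.im + 8 * j + 4 by linarith]; push_cast; rw [show (8 : ZMod 8) = 0 from rfl]; ring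
  unfold IsPrimary
  rw [hre]
  rcases him with him | him
  · rw [him]
  · rw [him, ← primaryRes_add_four_iff]

/-- **The common sign**: for `b ≡ c (mod 4√−2)`, `primary b · c = primary c · b` (the same unit `±1` makes both primary; both sides vanish if
`re` is even). [cite: Rajwade1968, Thm. 1] [cite: IrelandRosen1990, Ch. 9 §7, Lemma 7 (analogue)] -/
theorem primary_mul_eq_primary_mul_of_dvd_sub {b c : ℤ√(-2)} (h : (4 * Zsqrtd.sqrtd : ℤ√(-2)) ∣ b - c) :
    primary b * c = primary c * b := by
  have hneg : (4 * Zsqrtd.sqrtd : ℤ√(-2)) ∣ -b - -c := by rw [show -b - -c = -(b - c) by ring, dvd_neg]; exact h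
  have h1 := isPrimary_iff_of_dvd_sub h
  have h2 := isPrimary_iff_of_dvd_sub hneg
  unfold primary
  by_cases hb : IsPrimary b
  · rw [if_pos hb, if_pos (h1.mp hb)]; ring
  · rw [if_neg hb, if_neg (fun hc => hb (h1.mpr hc))]
    by_cases hb' : IsPrimary (-b)
    · rw [if_pos hb', if_pos (h2.mp hb')]; ring
    · rw [if_neg hb', if_neg (fun hc => hb' (h2.mpr hc))]; ring

/-- `primary` (the primary associate, `0` off the odd elements) as a monoid homomorphism of `ℤ[√−2]`. [cite: IrelandRosen1990, Ch. 9 §7, Lemma 7 (analogue)] -/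
def primaryHom : ℤ√(-2) →* ℤ√(-2) where
  toFun := primary
  map_one' := primary_of_isUnit isUnit_one
  map_mul' := primary_mul

/-- Unfolding `primaryHom`. [cite: IrelandRosen1990, Ch. 9 §7, Lemma 7 (analogue)] -/
theorem primaryHom_apply (z : ℤ√(-2)) : primaryHom z = primary z := rfl

/-! ### §2 Generators of the primes of `𝓞 K` in `ℤ[√−2]` -/

section Gen

variable (hK : FieldData θ)
include hK

/-- **A generator `gen v ∈ ℤ[√−2]` of the prime `𝔭_v` of `𝓞 K`** (`ℤ[√−2]` is Euclidean, hence principal). [cite: Marcus2018, Ch. 5 Exercise 9 (m = −2)] -/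
def gen (v : HeightOneSpectrum (𝓞 K)) : ℤ√(-2) :=
  Submodule.IsPrincipal.generator (Ideal.comap (hK.ringEquiv : ℤ√(-2) →+* 𝓞 K) v.asIdeal)

/-- `(gen v)` is the transported ideal `𝔭_v ∩ ℤ[√−2]`. [cite: Marcus2018, Ch. 5 Exercise 9 (m = −2)] -/
theorem span_gen (v : HeightOneSpectrum (𝓞 K)) :
    Ideal.span {gen hK v} = Ideal.comap (hK.ringEquiv : ℤ√(-2) →+* 𝓞 K) v.asIdeal :=
  Ideal.span_singleton_generator _

/-- **`𝔭_v = (gen v)`** in `𝓞 K`. [cite: Marcus2018, Ch. 5 Exercise 9 (m = −2)] -/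
theorem span_ringEquiv_gen (v : HeightOneSpectrum (𝓞 K)) : Ideal.span {hK.ringEquiv (gen hK v)} = v.asIdeal := by
  have h := congrArg (Ideal.map (hK.ringEquiv : ℤ√(-2) →+* 𝓞 K)) (span_gen hK v)
  rw [Ideal.map_span, Set.image_singleton,
    Ideal.map_comap_of_surjective (hK.ringEquiv : ℤ√(-2) →+* 𝓞 K) hK.ringEquiv.surjective] at h
  exact h

/-- `x ∈ 𝔭_v ↔ gen v ∣ x` (read in `ℤ[√−2]`). [cite: Marcus2018, Ch. 5 Exercise 9 (m = −2)] -/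
theorem mem_asIdeal_iff (v : HeightOneSpectrum (𝓞 K)) (x : 𝓞 K) : x ∈ v.asIdeal ↔ gen hK v ∣ hK.ringEquiv.symm x := by
  rw [← span_ringEquiv_gen hK v, Ideal.mem_span_singleton]
  conv_lhs => rw [← hK.ringEquiv.apply_symm_apply x]
  exact map_dvd_iff hK.ringEquiv

/-- `hK.ringEquiv z ∈ 𝔭_v ↔ gen v ∣ z`. [cite: Marcus2018, Ch. 5 Exercise 9 (m = −2)] -/
theorem ringEquiv_mem_asIdeal_iff (v : HeightOneSpectrum (𝓞 K)) (z : ℤ√(-2)) : hK.ringEquiv z ∈ v.asIdeal ↔ gen hK v ∣ z := by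
  rw [mem_asIdeal_iff hK, RingEquiv.symm_apply_apply]

/-- `gen v` is not a unit. [cite: Marcus2018, Ch. 5 Exercise 9 (m = −2)] -/
theorem not_isUnit_gen (v : HeightOneSpectrum (𝓞 K)) : ¬ IsUnit (gen hK v) := by
  intro hu
  apply v.isPrime.ne_top
  rw [← span_ringEquiv_gen hK v, Ideal.span_singleton_eq_top]
  exact hu.map _

/-- `gen v ≠ 0`. [cite: Marcus2018, Ch. 5 Exercise 9 (m = −2)] -/
theorem gen_ne_zero (v : HeightOneSpectrum (𝓞 K)) : gen hK v ≠ 0 := by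
  intro h0
  apply v.ne_bot
  rw [← span_ringEquiv_gen hK v, h0, map_zero, Ideal.span_singleton_eq_bot]

/-- `N(gen v) ≠ 1`. [cite: Marcus2018, Ch. 5 Exercise 9 (m = −2)] -/
theorem norm_gen_ne_one (v : HeightOneSpectrum (𝓞 K)) : (gen hK v).norm ≠ 1 := fun h1 =>
  not_isUnit_gen hK v ((Zsqrtd.norm_eq_one_iff' (by norm_num) _).mp h1)

/-- `gen v` is prime in `ℤ[√−2]`. [cite: Marcus2018, Ch. 5 Exercise 9 (m = −2)] -/
theorem prime_gen (v : HeightOneSpectrum (𝓞 K)) : Prime (gen hK v) := by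
  rw [← Ideal.span_singleton_prime (gen_ne_zero hK v), span_gen hK v]
  haveI := v.isPrime
  exact Ideal.comap_isPrime _ _

/-- **`c • 𝔭_v = ((gen v)‾)`**. [cite: SilvermanATAEC1994, II Ex. 2.30] -/
theorem smul_asIdeal_eq {c : K ≃ₐ[ℚ] K} (hc : c ≠ 1) (v : HeightOneSpectrum (𝓞 K)) :
    (c • v).asIdeal = Ideal.span {hK.ringEquiv (star (gen hK v))} := by
  rw [Literature.NumberTheory.Automorphic.HeightOneSpectrum.smul_asIdeal, ← span_ringEquiv_gen hK v, Ideal.pointwise_smul_def,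
    Ideal.map_span, Set.image_singleton, MulSemiringAction.toRingHom_apply, hK.smul_ringEquiv hc]

/-- `gen (c • v)` and `(gen v)‾` are associated. [cite: SilvermanATAEC1994, II Ex. 2.30] -/
theorem associated_gen_smul {c : K ≃ₐ[ℚ] K} (hc : c ≠ 1) (v : HeightOneSpectrum (𝓞 K)) :
    Associated (gen hK (c • v)) (star (gen hK v)) := by
  have h1 := span_ringEquiv_gen hK (c • v)
  rw [smul_asIdeal_eq hK hc v, Ideal.span_singleton_eq_span_singleton] at h1
  simpa only [RingEquiv.symm_apply_apply] using h1.map hK.ringEquiv.symm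

/-- **`(√−2) ∣ 𝔭_v ↔ re(gen v)` is even** (`√−2` and `gen v` are primes of the PID `ℤ[√−2]`; `√−2 ∣ z ↔ 2 ∣ re z`). [cite: Rajwade1968, Thm. 1] -/
theorem sqrtIdeal_le_iff (v : HeightOneSpectrum (𝓞 K)) : hK.sqrtIdeal ≤ v.asIdeal ↔ 2 ∣ (gen hK v).re := by
  rw [FieldData.sqrtIdeal, Ideal.span_singleton_le_iff_mem, ringEquiv_mem_asIdeal_iff hK, ← sqrtd_dvd_iff]
  have hprime : Prime (Zsqrtd.sqrtd : ℤ√(-2)) := prime_of_norm_eq_prime Nat.prime_two norm_sqrtd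
  constructor
  · intro h
    exact ((prime_gen hK v).irreducible.associated_of_dvd hprime.irreducible h).symm.dvd
  · intro h
    exact (hprime.irreducible.associated_of_dvd (prime_gen hK v).irreducible h).symm.dvd

/-- `(4√−2) ∣ 𝔭_v ↔ (√−2) ∣ 𝔭_v`. [cite: Rajwade1968, Thm. 1] -/
theorem modulus_le_iff (v : HeightOneSpectrum (𝓞 K)) : hK.modulus ≤ v.asIdeal ↔ hK.sqrtIdeal ≤ v.asIdeal := by
  rw [hK.modulus_eq_sqrtIdeal_pow]
  exact v.isPrime.pow_le_iff (by norm_num)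

/-- **`(√−2) ∣ 𝔭_v ↔ 2 ∈ 𝔭_v`** (`(√−2)² = −2`). [cite: Rajwade1968, Thm. 1] -/
theorem sqrtIdeal_le_iff_two_mem (v : HeightOneSpectrum (𝓞 K)) : hK.sqrtIdeal ≤ v.asIdeal ↔ (2 : 𝓞 K) ∈ v.asIdeal := by
  have hsq : (hK.ringEquiv Zsqrtd.sqrtd : 𝓞 K) ^ 2 = -(2 : 𝓞 K) := by
    apply RingOfIntegers.ext
    show algebraMap (𝓞 K) K (hK.ringEquiv Zsqrtd.sqrtd ^ 2) = algebraMap (𝓞 K) K (-(2 : 𝓞 K))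
    rw [map_pow, map_neg, map_ofNat, ← RingOfIntegers.coe_eq_algebraMap, hK.coe_ringEquiv_sqrtd, hK.sq_eq]
  rw [FieldData.sqrtIdeal, Ideal.span_singleton_le_iff_mem]
  constructor
  · intro h
    have h2 := v.asIdeal.pow_mem_of_mem h 2 two_pos
    rw [hsq, Ideal.neg_mem_iff] at h2
    exact h2
  · intro h
    have h2 : (hK.ringEquiv Zsqrtd.sqrtd : 𝓞 K) ^ 2 ∈ v.asIdeal := by rw [hsq, Ideal.neg_mem_iff]; exact h
    exact v.isPrime.mem_of_pow_mem 2 h2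

/-- Off `(√−2)`, `re(gen v)` is odd. [cite: Rajwade1968, Thm. 1] -/
theorem re_gen_odd {v : HeightOneSpectrum (𝓞 K)} (hv : ¬ hK.sqrtIdeal ≤ v.asIdeal) : (gen hK v).re % 2 = 1 := by
  rw [sqrtIdeal_le_iff hK] at hv
  omega

end Gen

end Literature.NumberTheory.QuadraticFields.SqrtNegTwo

end
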